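import Mathlib
import Summits.Ventures.HodgeRepro2.T5GaussianField
import Summits.Ventures.HodgeRepro2.T5GaussianPlace
import Summits.Ventures.HodgeRepro2.T6N5LocalSignModelCMNonSplit
import Summits.Ventures.HodgeRepro2.T6N5LocalSignModelCMWitness
import Summits.Ventures.HodgeRepro2.T6N5LocalSignModelDichotomy

/-!
# T6N5LocalSignModelCMBranch — Tier 6, M2 sub-step N5 (t6-p8's half): THE BRANCH OF THE CM FORM'S PLACE DATA AT
THE PLACE OF `E⁺` UNDER `w₂` IS DECIDED — `2` is a uniformiser of `(E⁺)_v` because `[E⁺ : ℚ] = 1`, and it ramifies in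
`ℚ₂(i)`

`T6N5LocalSignModelDichotomy` decides the branch of `placeData` on the base `ℚ` (`placeData_v₂_eq_inr`); on the CM
form's base `E⁺ = maximalRealSubfield ℚ(ζ₄)` — a subfield isomorphic to `ℚ`, not `ℚ` — the branch at the place
`placeUnder E⁺ w₂` of `T6N5LocalSignModelCMNonSplit` was left open (owner file §25). This file decides it, through
the ELEMENT `2` and the degree `[E⁺ : ℚ] = 1`, with no transport of place data across `E⁺ ≅ ℚ`:
* `exists_algebraMap_eq` / `exists_intCast_eq` — in a number field `F` of degree one every element is rational
  (Mathlib's `Algebra.finrank_eq_one_iff_bijective_algebraMap`) and every integer is a rational integer (`ℤ` is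
  integrally closed in `ℚ`, `IsIntegrallyClosed.isIntegral_iff`);
* `asIdeal_eq_span_two` — a finite place of such an `F` containing `2` IS the prime `(2)` (an odd rational integer
  in the place would put `1` in it); `val_two` / `irreducible_two` — hence `v(2) = exp(−1)` in `F_v` and `2` is a
  uniformiser of `O_{F_v}` (p4's `T5AdicCompletionConductor.irreducible_iff_val_eq_exp_neg_one`);
* `isEmpty_inertPlace_of_two` / `nonempty_ramPlace_of_two` — for a place `w` of `L ⊇ F` above `v` in which `2` is not
  irreducible, no inert datum exists at `(v, w)` (two uniformisers of `F_v` are associated,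
  `T6N5LocalSignModelDichotomy.irreducible_algebraMap_iff`) and, under the global hypotheses, a ramified datum does;
* on `E = ℚ(ζ₄)`, `E⁺ = maximalRealSubfield E`: `finrank_maximalRealSubfield_eq_one` (`[E⁺ : ℚ] = 1` from the tower
  `[E : ℚ] = [E : E⁺] · [E⁺ : ℚ]` with both degrees `2`), `two_mem_placeUnder_w₂`, `not_irreducible_two_of_two_mem`
  (p4's `2 = ζ³ π²` at ANY finite place of `ℚ(ζ₄)` containing `2`), **`isEmpty_inertPlace_cm`** /
  `eq_w₂_of_liesOver` / **`nonempty_ramPlace_cm`** (THE BRANCH: at the place of `E⁺` under `w₂`, ramified),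
  `placeAbove_eq_w₂` / `two_mem_placeAbove` / `ramPlace_placeAbove` (the same at the pair `localInputAt` reads),
  **`placeData_cm_eq_inr`** (the chosen place data of the CM form at that place are ramified),
  **`localInputAt_toyFamilyCM_w₂`** (the CM toy family's local input there IS the ramified toy input),
  `ofCM_toyFamilyCM_D_w₂`, **`gaussian_cm_witness_ram`** (`gaussian_cm_witness` read at the place under `w₂`: the
  sign model's datum there is the ramified statement of record's datum on the gen-6 ramified toy and its `Solves`
  conjunct there is Theorem N5.T2 on it) — the CM-form counterpart of `gaussian_global_witness_ram`.
Definition lane, Mathlib + the cell's files only; no display; nothing here touches the host datum.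
README §8(d): uses an L-value-free non-vanishing device: NO.
-/

namespace Summit.Ventures.HodgeRepro2.T6.N5LocalSignModelCMBranch

open Summit.Ventures.HodgeRepro2 IsDedekindDomain HeightOneSpectrum NumberField
  Summit.Ventures.HodgeRepro2.T6.N5LocalDatum Summit.Ventures.HodgeRepro2.T6.N5Local
  Summit.Ventures.HodgeRepro2.T6.N5LocalRamToyEps Summit.Ventures.HodgeRepro2.T6.N5LocalInertToyEps
  Summit.Ventures.HodgeRepro2.T6.N5Rich Summit.Ventures.HodgeRepro2.T6.N5LocalSignModel
  Summit.Ventures.HodgeRepro2.T6.N5LocalSignModelGlobal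
  Summit.Ventures.HodgeRepro2.T6.N5LocalSignModelGlobalWitness
  Summit.Ventures.HodgeRepro2.T6.N5LocalSignModelCM Summit.Ventures.HodgeRepro2.T6.N5LocalSignModelCMWitness
  Summit.Ventures.HodgeRepro2.T6.N5LocalSignModelCMNonSplit
  Summit.Ventures.HodgeRepro2.T6.N5LocalSignModelDichotomy

noncomputable section

/-! ### A number field of degree one: every integer is a rational integer, and `2` is a uniformiser at a place
containing it -/

section DegreeOne

variable {F : Type} [Field F] [NumberField F]

/-- In a number field of degree one every element is rational (Mathlib's
`Algebra.finrank_eq_one_iff_bijective_algebraMap`). -/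
theorem exists_algebraMap_eq (hF : Module.finrank ℚ F = 1) (x : F) : ∃ q : ℚ, algebraMap ℚ F q = x :=
  (Algebra.finrank_eq_one_iff_bijective_algebraMap.mp hF).2 x

/-- Every integer of a number field of degree one is a rational integer: it is rational and integral over `ℤ`,
and `ℤ` is integrally closed in `ℚ`. -/
theorem exists_intCast_eq (hF : Module.finrank ℚ F = 1) (x : RingOfIntegers F) :
    ∃ n : ℤ, (n : RingOfIntegers F) = x := by
  obtain ⟨q, hq⟩ := exists_algebraMap_eq hF (x : F)
  have hint : IsIntegral ℤ (x : F) := x.isIntegral_coe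
  rw [← hq, isIntegral_algebraMap_iff (algebraMap ℚ F).injective] at hint
  haveI : IsIntegrallyClosed ℤ := GCDMonoid.toIsIntegrallyClosed
  obtain ⟨n, hn⟩ := IsIntegrallyClosed.isIntegral_iff.mp hint
  refine ⟨n, RingOfIntegers.ext ?_⟩
  rw [← hq, ← hn, eq_intCast, map_intCast]
  exact map_intCast (algebraMap (RingOfIntegers F) F) n

/-- A finite place of a number field of degree one containing `2` IS the prime `(2)`: every element of the place
is a rational integer, and an odd one would put `1` in the place. -/
theorem asIdeal_eq_span_two (hF : Module.finrank ℚ F = 1) (v : HeightOneSpectrum (RingOfIntegers F))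
    (h2 : (2 : RingOfIntegers F) ∈ v.asIdeal) : v.asIdeal = Ideal.span {2} := by
  refine le_antisymm ?_ ?_
  · intro x hx
    obtain ⟨n, rfl⟩ := exists_intCast_eq hF x
    rcases Int.even_or_odd n with ⟨k, hk⟩ | ⟨k, hk⟩
    · rw [Ideal.mem_span_singleton, hk]
      exact ⟨k, by push_cast; ring⟩
    · exfalso
      apply v.isPrime.ne_top
      rw [Ideal.eq_top_iff_one]
      have : (1 : RingOfIntegers F) = (n : RingOfIntegers F) - 2 * (k : RingOfIntegers F) := by
        rw [hk]; push_cast; ring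
      rw [this]
      exact Ideal.sub_mem _ hx (Ideal.mul_mem_right _ _ h2)
  · rw [Ideal.span_le, Set.singleton_subset_iff]
    exact h2

/-- `v(2) = exp(−1)` in `F_v` at a place `v` of a degree-one number field containing `2`. -/
theorem val_two (hF : Module.finrank ℚ F = 1) (v : HeightOneSpectrum (RingOfIntegers F))
    (h2 : (2 : RingOfIntegers F) ∈ v.asIdeal) : Valued.v (2 : v.adicCompletion F) = WithZero.exp (-1) := by
  have e := IsDedekindDomain.HeightOneSpectrum.valuedAdicCompletion_eq_valuation (K := F) v
    (2 : RingOfIntegers F)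
  rw [IsDedekindDomain.HeightOneSpectrum.valuation_of_algebraMap,
    IsDedekindDomain.HeightOneSpectrum.intValuation_singleton v two_ne_zero (asIdeal_eq_span_two hF v h2)] at e
  simp only [Algebra.cast, map_ofNat] at e
  exact e

/-- `2` is a uniformiser of `O_{F_v}` (p4's `T5AdicCompletionConductor.irreducible_iff_val_eq_exp_neg_one`). -/
theorem irreducible_two (hF : Module.finrank ℚ F = 1) (v : HeightOneSpectrum (RingOfIntegers F))
    (h2 : (2 : RingOfIntegers F) ∈ v.asIdeal) : Irreducible (2 : v.adicCompletionIntegers F) :=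
  (T5AdicCompletionConductor.irreducible_iff_val_eq_exp_neg_one v (2 : v.adicCompletionIntegers F)).mpr
    (val_two hF v h2)

variable {L : Type} [Field L] [NumberField L] [Algebra F L]

/-- NO INERT DATUM at `(v, w)` when `2` is not irreducible in `O_{L_w}`: an inert datum's uniformiser stays
irreducible in `O_{L_w}`, and it is associated to the uniformiser `2` (`irreducible_algebraMap_iff`). -/
theorem isEmpty_inertPlace_of_two (hF : Module.finrank ℚ F = 1) (v : HeightOneSpectrum (RingOfIntegers F))
    (h2 : (2 : RingOfIntegers F) ∈ v.asIdeal) (w : HeightOneSpectrum (RingOfIntegers L))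
    [w.asIdeal.LiesOver v.asIdeal] (hw : ¬ Irreducible (2 : w.adicCompletionIntegers L)) :
    IsEmpty (InertPlace v w) := by
  refine ⟨fun Q => hw ?_⟩
  have h := (irreducible_algebraMap_iff v w Q.hϖ (irreducible_two hF v h2)).mp Q.hϖS
  rwa [map_ofNat] at h

/-- A RAMIFIED DATUM EXISTS at `(v, w)` under the global hypotheses when `2` is not irreducible in `O_{L_w}`
(`nonempty_ramPlace_iff` with the uniformiser `2`). -/
theorem nonempty_ramPlace_of_two (hF : Module.finrank ℚ F = 1) (v : HeightOneSpectrum (RingOfIntegers F))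
    (h2 : (2 : RingOfIntegers F) ∈ v.asIdeal) (w : HeightOneSpectrum (RingOfIntegers L))
    [w.asIdeal.LiesOver v.asIdeal] (hKL : Module.finrank F L = 2)
    (huniq : ∀ w' : HeightOneSpectrum (RingOfIntegers L), w'.asIdeal.LiesOver v.asIdeal → w' = w)
    (hw : ¬ Irreducible (2 : w.adicCompletionIntegers L)) : Nonempty (RamPlace v w) :=
  (nonempty_ramPlace_iff v w hKL huniq).mpr ⟨2, irreducible_two hF v h2, by rw [map_ofNat]; exact hw⟩

end DegreeOne

/-! ### `E = ℚ(ζ₄)`, `E⁺ = maximalRealSubfield E`: the branch at the place under `w₂` is the ramified one -/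

section Gaussian

open T5GaussianField

/-- `[E⁺ : ℚ] = 1` for `E = ℚ(ζ₄)`: the tower `[E : ℚ] = [E : E⁺] · [E⁺ : ℚ]` with `[E : ℚ] = 2` (p4's
`T5GaussianField.finrank_eq_two`) and `[E : E⁺] = 2` (`IsCMField`). -/
theorem finrank_maximalRealSubfield_eq_one : Module.finrank ℚ (maximalRealSubfield L) = 1 := by
  letI := isCMField_L
  have h := Module.finrank_mul_finrank ℚ (maximalRealSubfield L) L
  rw [finrank_maximalRealSubfield_eq_two L, T5GaussianField.finrank_eq_two] at h
  omega

/-- `2` lies in the place of any base `K ⊆ ℚ(ζ₄)` under `w₂`. -/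
theorem two_mem_placeUnder_w₂ (K : Type) [Field K] [Algebra K L] :
    (2 : RingOfIntegers K) ∈ (placeUnder K w₂).asIdeal := by
  rw [mem_placeUnder_iff, map_ofNat]
  exact two_mem_w₂

/-- `2` is not irreducible in `O_{L_{w'}}` at ANY finite place `w'` of `ℚ(ζ₄)` containing `2` (p4's `2 = ζ³ π²`,
`T5GaussianPlace.not_irreducible_algebraMap_two`; such a place lies over `v₂`). -/
theorem not_irreducible_two_of_two_mem (w' : HeightOneSpectrum (RingOfIntegers L))
    (h2 : (2 : RingOfIntegers L) ∈ w'.asIdeal) : ¬ Irreducible (2 : w'.adicCompletionIntegers L) := by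
  haveI := liesOver_v₂_of_two_mem w' h2
  have h := T5GaussianPlace.not_irreducible_algebraMap_two w'
  rwa [map_ofNat] at h

/-- THE BRANCH DECIDED, part 1: no inert datum at `(placeUnder E⁺ w₂, w₂)`. -/
theorem isEmpty_inertPlace_cm : IsEmpty (InertPlace (placeUnder (maximalRealSubfield L) w₂) w₂) :=
  isEmpty_inertPlace_of_two finrank_maximalRealSubfield_eq_one _ (two_mem_placeUnder_w₂ _) w₂
    (not_irreducible_two_of_two_mem w₂ two_mem_w₂)

/-- `w₂` is the only place of `ℚ(ζ₄)` above the place of `E⁺` under it (the `ns` structure of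
`isNonSplit_placeUnder_w₂`). -/
theorem eq_w₂_of_liesOver (K : Type) [Field K] [Algebra K L] (w' : HeightOneSpectrum (RingOfIntegers L))
    (hw' : w'.asIdeal.LiesOver (placeUnder K w₂).asIdeal) : w' = w₂ :=
  (isNonSplit_placeUnder_w₂ K).unique hw' (liesOver_placeUnder K w₂)

/-- THE BRANCH DECIDED, part 2: a ramified datum at `(placeUnder E⁺ w₂, w₂)`. -/
theorem nonempty_ramPlace_cm : Nonempty (RamPlace (placeUnder (maximalRealSubfield L) w₂) w₂) :=
  letI := isCMField_L
  nonempty_ramPlace_of_two finrank_maximalRealSubfield_eq_one _ (two_mem_placeUnder_w₂ _) w₂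
    (finrank_maximalRealSubfield_eq_two L) (eq_w₂_of_liesOver _) (not_irreducible_two_of_two_mem w₂ two_mem_w₂)

/-- The place `placeAbove` chosen by the `ns` structure at `placeUnder K w₂` is `w₂`. -/
theorem placeAbove_eq_w₂ (K : Type) [Field K] [Algebra K L] :
    placeAbove (isNonSplit_placeUnder_w₂ K) = w₂ :=
  (placeAbove_unique (isNonSplit_placeUnder_w₂ K) w₂ (liesOver_placeUnder K w₂)).symm

/-- `2 ∈ placeAbove (isNonSplit_placeUnder_w₂ K)`. -/
theorem two_mem_placeAbove (K : Type) [Field K] [Algebra K L] :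
    (2 : RingOfIntegers L) ∈ (placeAbove (isNonSplit_placeUnder_w₂ K)).asIdeal := by
  rw [placeAbove_eq_w₂]
  exact two_mem_w₂

/-- A ramified datum at `(placeUnder E⁺ w₂, placeAbove _)` — the pair the CM form's `localInputAt` reads. -/
theorem ramPlace_placeAbove :
    letI := isCMField_L
    Nonempty (RamPlace (placeUnder (maximalRealSubfield L) w₂)
      (placeAbove (isNonSplit_placeUnder_w₂ (maximalRealSubfield L)))) :=
  letI := isCMField_L
  nonempty_ramPlace_of_two finrank_maximalRealSubfield_eq_one _ (two_mem_placeUnder_w₂ _) _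
    (finrank_maximalRealSubfield_eq_two L) (placeAbove_unique (isNonSplit_placeUnder_w₂ _))
    (not_irreducible_two_of_two_mem _ (two_mem_placeAbove _))

/-- THE CHOSEN PLACE DATA OF THE CM FORM at the place of `E⁺` under `w₂` ARE RAMIFIED. -/
theorem placeData_cm_eq_inr :
    letI := isCMField_L
    ∃ Q : RamPlace (placeUnder (maximalRealSubfield L) w₂)
        (placeAbove (isNonSplit_placeUnder_w₂ (maximalRealSubfield L))),
      placeData (placeUnder (maximalRealSubfield L) w₂)
        (placeAbove (isNonSplit_placeUnder_w₂ (maximalRealSubfield L))) (finrank_maximalRealSubfield_eq_two L)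
        (placeAbove_unique (isNonSplit_placeUnder_w₂ (maximalRealSubfield L))) = Sum.inr Q :=
  letI := isCMField_L
  placeData_eq_inr _ _ (finrank_maximalRealSubfield_eq_two L)
    (placeAbove_unique (isNonSplit_placeUnder_w₂ (maximalRealSubfield L))) ramPlace_placeAbove.some

/-- THE READING OF THE CM WITNESS IN KERNEL: the CM toy family's local input at the place of `E⁺` under `w₂` IS the
ramified toy input (the owner file §25's open line, now a theorem). -/
theorem localInputAt_toyFamilyCM_w₂ :
    letI := isCMField_L
    ∃ Q : RamPlace (placeUnder (maximalRealSubfield L) w₂)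
        (placeAbove (isNonSplit_placeUnder_w₂ (maximalRealSubfield L))),
      localInputAt (finrank_maximalRealSubfield_eq_two L) (toyFamilyCM L)
          (isNonSplit_placeUnder_w₂ (maximalRealSubfield L)) =
        toyInputRam (placeUnder (maximalRealSubfield L) w₂)
          (placeAbove (isNonSplit_placeUnder_w₂ (maximalRealSubfield L))) Q := by
  letI := isCMField_L
  obtain ⟨Q, hQ⟩ := toyInput_placeData_eq_ram (placeUnder (maximalRealSubfield L) w₂)
    (placeAbove (isNonSplit_placeUnder_w₂ (maximalRealSubfield L))) (finrank_maximalRealSubfield_eq_two L)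
    (placeAbove_unique (isNonSplit_placeUnder_w₂ (maximalRealSubfield L))) ramPlace_placeAbove.some
  exact ⟨Q, (ofUnique_toyThreeData (placeUnder (maximalRealSubfield L) w₂)
    (placeAbove (isNonSplit_placeUnder_w₂ (maximalRealSubfield L))) (finrank_maximalRealSubfield_eq_two L)
    (placeAbove_unique (isNonSplit_placeUnder_w₂ (maximalRealSubfield L)))).trans hQ⟩

/-- The datum of the CM toy family at the place of `E⁺` under `w₂` is the ramified statement of record's datum on
the ramified toy. -/
theorem ofCM_toyFamilyCM_D_w₂ :
    letI := isCMField_L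
    ∃ Q : RamPlace (placeUnder (maximalRealSubfield L) w₂)
        (placeAbove (isNonSplit_placeUnder_w₂ (maximalRealSubfield L))),
      (PlaceFamily.ofCM L (toyFamilyCM L)).D (Sum.inl (placeUnder (maximalRealSubfield L) w₂)) =
        (toyInputRam (placeUnder (maximalRealSubfield L) w₂)
          (placeAbove (isNonSplit_placeUnder_w₂ (maximalRealSubfield L))) Q).D := by
  letI := isCMField_L
  obtain ⟨Q, hQ⟩ := localInputAt_toyFamilyCM_w₂
  refine ⟨Q, ?_⟩
  rw [PlaceFamily.D_of_ns _ (kindOf_placeUnder_w₂ (maximalRealSubfield L))]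
  exact congrArg LocalInput.D hQ

/-- `gaussian_cm_witness` READ AT THE PLACE OF `E⁺` UNDER `w₂`: the sign model's datum there is the ramified statement
of record's datum on the gen-6 ramified toy, and its `Solves` conjunct there is Theorem N5.T2 on that datum — the
CM-form counterpart of `gaussian_global_witness_ram`. -/
theorem gaussian_cm_witness_ram :
    letI := isCMField_L
    ∃ S : SignModel (GlobalIndex (maximalRealSubfield L)), S.kind = kindOf (maximalRealSubfield L) L ∧
      (∃ Q : RamPlace (placeUnder (maximalRealSubfield L) w₂)
          (placeAbove (isNonSplit_placeUnder_w₂ (maximalRealSubfield L))),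
        S.D (Sum.inl (placeUnder (maximalRealSubfield L) w₂)) =
          (toyInputRam (placeUnder (maximalRealSubfield L) w₂)
            (placeAbove (isNonSplit_placeUnder_w₂ (maximalRealSubfield L))) Q).D) ∧
      LocalSolution (S.D (Sum.inl (placeUnder (maximalRealSubfield L) w₂)))
        (S.ξ (Sum.inl (placeUnder (maximalRealSubfield L) w₂))) ∧ S.Solves ∧ S.RealCondB := by
  letI := isCMField_L
  obtain ⟨S, hk, hD, hsol, hre⟩ := gaussian_cm_witness
  obtain ⟨Q, hQ⟩ := ofCM_toyFamilyCM_D_w₂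
  refine ⟨S, hk, ⟨Q, ?_⟩,
    hsol (Sum.inl (placeUnder (maximalRealSubfield L) w₂))
      (by rw [hk]; exact kindOf_placeUnder_w₂ (maximalRealSubfield L)), hsol, hre⟩
  rw [hD]
  exact hQ

end Gaussian

end

end Summit.Ventures.HodgeRepro2.T6.N5LocalSignModelCMBranch
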